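import Literature.MathematicalPhysics.QuantumFieldTheory.Balaban1983to89.B9Eq315QkSingleBondLetter
import Literature.MathematicalPhysics.QuantumFieldTheory.Balaban1983to89.B9Eq316PenaltyPointwiseBoundHeightFree

/-!
# `Balaban1983to89.B9Eq316PenaltyStencilLetterTower` — T. Bałaban, *Propagators for lattice gauge theories in a background field*, Commun. Math. Phys. **99**
# (1985) 389–434 [Balaban1985BackgroundPropagators] (3.16) p. 393 (the penalty `Q*aQ`), (3.26) p. 395 (the local part `Δ(U) + D_UD*_U + Q*aQ` of `Δ_a`), (3.69)
# p. 404, (3.35)–(3.37) p. 396, with [Balaban1985Averaging] p. 24 «this definition is local», (125)–(127) pp. 36–37: **THE STENCIL LETTER OF THE TOWER PENALTY,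
# HEIGHT-FREE — `‖((Q_k(U)†(a•Q_k(U)))v)(b)‖ ≤ p₂·Σ_{i} ‖P_{st(b,i)}v‖` over the `2d+1` unit blocks `Π(b₋)`, `Π(b₋) ± e_κ` (block distance ≤ 1), with
# `p₂ = |a|·M_φ′M_φ·e^{100d(d+1)L^dA}·2d·2C_Q∕√c₁`, `C_Q = M_φ′M_φ·e^{√(L^d)√(2d)·102(d+1)²L·ε_s∕(1−r)}`, on the diagonal `c₀(L^{n+1})^d = c₁` — NO power of the
# height `n`** — the `hq`-slot of ne9-leaf-03 g78's (WKP) `B9Eq342SupNormDecayFromBlockDecayStencil.norm_apply_le_decay_of_letters_stencil` for the local part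
# `A₀,k`'s penalty (OFFER O-leaf03-g78-1 toward beta-an4's INTERFACE REQUEST D4): a block AVERAGE is controlled by the block `L²(c₀)` norm over `√c₁` with no
# `(L^{n+1})^{d∕2}` (locality + the height-free `L²` letter), and its ADJOINT spreads a unit-lattice value back with print's size (the sharp `k_{Q,k}`)

statement-level skeleton of published theorems with citation tags; proofs where landed; nothing here is a claim about the Yang–Mills mass gap

CITATION HEADER (lean-in-tree rule).  Audit cell `pub-balaban`, sub-cell `t4`, BINDER row NE9; filed by NE9 crux-team LEAF PROVER 03 (`b2b-balaban-t4-ne9-formalise-leaf-03`,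
gen 78; road ΔA-CT).  Imports this lineage's (SBLT) `B9Eq315QkSingleBondLetter` (`equiv_QkW_apply`, `norm_penalty_QkW_apply_le_local_of_values_diagonal`; through it
`B9Eq315QkLocalLetter` (`bigBlock_perSite_of_inBoxK`), `B9Ineq3137LocalSup.linCovIter_congr`, `B9Eq315QTower.QkOfU_apply_eq_linCovIter`) and ne9-leaf-02∕-06's
`B9Eq316PenaltyPointwiseBoundHeightFree` (`norm_QkW_le_of_geometric_window_diagonal`).  Sources READ first-hand in the held text layers
(`paper:balaban1985-cmp99-background-propagators` p. 393 (3.15)–(3.16); `paper:balaban1985-cmp98-averaging` p. 24, p. 36).  [folklore] bookkeeping; nothing of print's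
proofs is reproduced.

WHAT IS PROVED (sorry-free; proof lane — 0 `def`; [folklore]).
* §1 **`QkOfU_congr_local`** — `(Q_k(U)A)(c)` depends on `A` over the big blocks `c₋`, `c₋ + e_{c.2}` only (the cell's `linCovIter_congr`, [B7] p. 24).
* §2 `sqrt_weight_mul_norm_apply_le` (`√c₁·‖g(c)‖ ≤ ‖g‖_{L²(c₁)}`), `norm_restrict_le` (`‖v|_{zone}‖ ≤ ‖P_{c₋}v‖ + ‖P_{c₋+e}v‖`),
  **`norm_equiv_QkW_apply_le_blocks`** — `‖(Q_k(U)v)(c)‖ ≤ (C_Q∕√c₁)·(‖P_{c₋}v‖ + ‖P_{c₋+e_{c.2}}v‖)` on the diagonal: HEIGHT-FREE.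
* §3 `blocks_le_stencil_sum` (the zone's two blocks are among the `2d+1` stencil blocks), **`norm_penalty_QkW_apply_le_stencil`** — THE STENCIL LETTER above,
  and `tdist_stencil_le_one` (the stencil stays within block distance `1` of `Π(b₋)`, `1 ≤ m_i`).
HONEST SCOPE.  Composition BY NAME; crude constants (factor `2`, `L^d` in the exponent of `k_{Q,k}`); the loop window `Σ_{j<n+1} α_j ≤ A` and the bond window
`ε_j ≤ ε_s r^j` DISPLAYED; nothing of [B9] Thm 3.1∕3.3 asserted; «NE9 ⇐ the named binders»; NE9 NOT PRINTED ∕ NOT PROVED; row WALLED ON A MODEL (O-NE9-1; #5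
UNRULED); spine PROVED 0∕9; rung (B)+1 on a finite T⁴ — NOT infinite volume, NOT mass gap, NOT BetaPertH, NOT Clay.  HONEST DEPENDENCY: continuum YM on T⁴ ⇐
BetaPertH ∧ nine spine estimates (0/9 proved); BetaPertH ⇐ (D1) ∧ (D4) ∧ CAP+tail; G-an2-4 gates asym, D1 and NE2/3/4.  NEW file; nothing modified.  Net new
unproved facts: 0.
-/

noncomputable section

open scoped BigOperators

namespace Literature.MathematicalPhysics.QuantumFieldTheory.Balaban1983to89.B9Eq316PenaltyStencilLetterTower

open B4Sect5Torus (TSite tdist tdist_symm tdist_self)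
open B9SectCLatticeCarrier (Bond shift unshift shift_unshift unshift_shift)
open B9Eq311L2Pairing (WL2)
open B11Eq103H1Complex (BondL2K)
open B9Eq319QprimeTorus (fineP blockCoord)
open B7Prop1Explicit (U1 Wcx boxVec)
open B9Eq315QTorus (perCfg perCfg_apply cornerSite)
open B9Eq315QTorusOnto (liftSite)
open B9Eq315QTower (towerP UlevOf QkOfU QkOfU_apply_eq_linCovIter)
open B9Eq316TowerFlatIsOneStep (towerP_eq_fineP_pow siteCast)
open B9Eq326OperatorTower (QkW)
open B9Ineq3137LocalSup (linCovIter_congr)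
open B9Eq315QkLocalLetter (bigBlock_perSite_of_inBoxK)
open B9Eq349BlockDistanceWeight (tdist_shift_le_one)
open B9Eq316PenaltyPointwiseBoundHeightFree (norm_QkW_le_of_geometric_window_diagonal)
open B9Eq315QkSingleBondLetter (equiv_QkW_apply norm_penalty_QkW_apply_le_local_of_values_diagonal)

variable {d : ℕ} (L : ℕ) [NeZero L] (m : Fin d → ℕ) [∀ i, NeZero (m i)] (n : ℕ)
  {𝔸 : Type*} [NormedRing 𝔸] [NormedAlgebra ℂ 𝔸] [CompleteSpace 𝔸] [NormOneClass 𝔸]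
  {W : Type*} [NormedAddCommGroup W] [InnerProductSpace ℂ W] (φ : W ≃ₗ[ℂ] 𝔸) {c₀ c₁ : ℝ} [Fact (0 < c₀)] [Fact (0 < c₁)]
  (U : Bond d (towerP L m (n + 1)) → 𝔸ˣ) (hL : 1 ≤ L) (α : ℕ → ℝ) (hα0 : ∀ j, 0 ≤ α j) (hα1 : ∀ j, α j ≤ 1 / 64)
  (hU1 : ∀ (j : ℕ) (x : B7Prop1Explicit.Site d) (κ : Fin d), perCfg (towerP L m (j + 1)) (UlevOf L m (n + 1) U j) x κ ∈ U1 𝔸)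
  (hreg : ∀ (j : ℕ) (y : TSite d (towerP L m j)) (κ : Fin d) (r : Fin d → Fin L),
    ‖((Wcx L (perCfg (towerP L m (j + 1)) (UlevOf L m (n + 1) U j)) (cornerSite L y) κ (boxVec L r) : 𝔸ˣ) : 𝔸) - 1‖ ≤ α j)
  {Mφ Mφ' : ℝ} (hMφ : 0 ≤ Mφ) (hφ : ∀ w, ‖φ w‖ ≤ Mφ * ‖w‖) (hMφ' : 0 ≤ Mφ') (hφ' : ∀ X, ‖φ.symm X‖ ≤ Mφ' * ‖X‖)
  (εU : ℕ → ℝ) (hεU : ∀ j, 0 ≤ εU j)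
  (hUε : ∀ (j : ℕ) (b : Bond d (towerP L m (j + 1))), ‖(UlevOf L m (n + 1) U j b : 𝔸) - 1‖ ≤ εU j)
  {r εs : ℝ} (hr0 : 0 ≤ r) (hr1 : r < 1) (hεs : 0 ≤ εs) (hεg : ∀ j < n + 1, εU j ≤ εs * r ^ j)
  {PB : TSite d m → BondL2K ℂ d (towerP L m (n + 1)) c₀ W →L[ℂ] BondL2K ℂ d (towerP L m (n + 1)) c₀ W}
  (hPB : ∀ (y : TSite d m) (f : BondL2K ℂ d (towerP L m (n + 1)) c₀ W) (b : Bond d (towerP L m (n + 1))),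
    WL2.equiv ℂ (fun _ : Bond d (towerP L m (n + 1)) => c₀) W (PB y f) b =
      if blockCoord (L ^ (n + 1)) m (siteCast (towerP_eq_fineP_pow L m (n + 1)) b.1) = y then
        WL2.equiv ℂ (fun _ : Bond d (towerP L m (n + 1)) => c₀) W f b else 0)

/-! ## §1 The composite reads two big blocks only -/

omit [Fact (0 < c₀)] [Fact (0 < c₁)] in
/-- **`(Q_k(U)A)(c)` DEPENDS ON `A` OVER THE BIG BLOCKS `c₋`, `c₋ + e_{c.2}` ONLY** (the cell's `linCovIter_congr` on the box `B^k(c₋) ∪ B^k(c₊)` of [B7] p. 24,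
read on the torus through `QkOfU_apply_eq_linCovIter`). [folklore] [cite: Balaban1985Averaging, p.24, (127) p.37; Balaban1985BackgroundPropagators, (3.15) p.393] -/
theorem QkOfU_congr_local {A A' : Bond d (towerP L m (n + 1)) → 𝔸} (c : Bond d m)
    (hAA' : ∀ b, (blockCoord (L ^ (n + 1)) m (siteCast (towerP_eq_fineP_pow L m (n + 1)) b.1) = c.1 ∨
        blockCoord (L ^ (n + 1)) m (siteCast (towerP_eq_fineP_pow L m (n + 1)) b.1) = shift c.2 c.1) → A b = A' b) :
    QkOfU L m hL (n + 1) U α hα1 hU1 hreg A c = QkOfU L m hL (n + 1) U α hα1 hU1 hreg A' c := by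
  rw [QkOfU_apply_eq_linCovIter, QkOfU_apply_eq_linCovIter]
  congr 1
  refine linCovIter_congr L hL (n + 1) (liftSite c.1) c.2 (fun _ _ _ _ => rfl) fun x μ hx _ => ?_
  rw [perCfg_apply, perCfg_apply]
  rcases bigBlock_perSite_of_inBoxK L m (n + 1) c.1 c.2 x hx with hb | hb
  · exact hAA' _ (Or.inl hb)
  · exact hAA' _ (Or.inr hb)

/-! ## §2 One value of `Q_kv` against the block `L²` norms, height-free -/

omit [NeZero L] [∀ i, NeZero (m i)] [Fact (0 < c₀)] in
/-- `√c₁·‖g(c)‖ ≤ ‖g‖_{L²(c₁)}` (one term of `‖g‖² = Σ_c c₁‖g(c)‖²`). [folklore] [cite: Balaban1985BackgroundPropagators, (3.11) p.392] -/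
theorem sqrt_weight_mul_norm_apply_le (g : BondL2K ℂ d m c₁ W) (c : Bond d m) :
    Real.sqrt c₁ * ‖WL2.equiv ℂ (fun _ : Bond d m => c₁) W g c‖ ≤ ‖g‖ := by
  have hc₁ : (0 : ℝ) < c₁ := Fact.out
  have h := WL2.weight_mul_norm_sq_apply_le (𝕜 := ℂ) (w := fun _ : Bond d m => c₁) g c
  have h0 : 0 ≤ Real.sqrt c₁ * ‖WL2.equiv ℂ (fun _ : Bond d m => c₁) W g c‖ := by positivity
  have h2 : (Real.sqrt c₁ * ‖WL2.equiv ℂ (fun _ : Bond d m => c₁) W g c‖) ^ 2 ≤ ‖g‖ ^ 2 := by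
    rw [mul_pow, Real.sq_sqrt hc₁.le]; exact h
  have h3 := Real.sqrt_le_sqrt h2
  rwa [Real.sqrt_sq h0, Real.sqrt_sq (norm_nonneg _)] at h3

include hPB in
omit [NeZero L] [∀ i, NeZero (m i)] [NormedAlgebra ℂ 𝔸] [CompleteSpace 𝔸] [NormOneClass 𝔸] [Fact (0 < c₁)] in
/-- **THE RESTRICTION TO THE ZONE AGAINST THE TWO BLOCK NORMS**: for `v′(b) = 1_{Π(b₋) ∈ {y₁, y₂}}·v(b)`, `‖v′‖ ≤ ‖P_{y₁}v‖ + ‖P_{y₂}v‖` (sum over a union ≤ the two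
sums; squares). [folklore] [cite: Balaban1985BackgroundPropagators, (3.11) p.392, (3.49) p.399] -/
theorem norm_restrict_le (v : BondL2K ℂ d (towerP L m (n + 1)) c₀ W) (y₁ y₂ : TSite d m) :
    ‖(WL2.equiv ℂ (fun _ : Bond d (towerP L m (n + 1)) => c₀) W).symm (fun b =>
        if blockCoord (L ^ (n + 1)) m (siteCast (towerP_eq_fineP_pow L m (n + 1)) b.1) = y₁ ∨
            blockCoord (L ^ (n + 1)) m (siteCast (towerP_eq_fineP_pow L m (n + 1)) b.1) = y₂ then
          WL2.equiv ℂ (fun _ : Bond d (towerP L m (n + 1)) => c₀) W v b else 0)‖ ≤ ‖PB y₁ v‖ + ‖PB y₂ v‖ := by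
  have hc₀ : (0 : ℝ) < c₀ := Fact.out
  set v' := (WL2.equiv ℂ (fun _ : Bond d (towerP L m (n + 1)) => c₀) W).symm (fun b =>
        if blockCoord (L ^ (n + 1)) m (siteCast (towerP_eq_fineP_pow L m (n + 1)) b.1) = y₁ ∨
            blockCoord (L ^ (n + 1)) m (siteCast (towerP_eq_fineP_pow L m (n + 1)) b.1) = y₂ then
          WL2.equiv ℂ (fun _ : Bond d (towerP L m (n + 1)) => c₀) W v b else 0) with hv'
  -- termwise: `c₀‖v′(b)‖² ≤ c₀‖(P₁v)(b)‖² + c₀‖(P₂v)(b)‖²`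
  have hterm : ∀ b, c₀ * ‖WL2.equiv ℂ (fun _ : Bond d (towerP L m (n + 1)) => c₀) W v' b‖ ^ 2 ≤
      c₀ * ‖WL2.equiv ℂ (fun _ : Bond d (towerP L m (n + 1)) => c₀) W (PB y₁ v) b‖ ^ 2 +
        c₀ * ‖WL2.equiv ℂ (fun _ : Bond d (towerP L m (n + 1)) => c₀) W (PB y₂ v) b‖ ^ 2 := by
    intro b
    rw [hv', Equiv.apply_symm_apply, hPB, hPB]
    by_cases h1 : blockCoord (L ^ (n + 1)) m (siteCast (towerP_eq_fineP_pow L m (n + 1)) b.1) = y₁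
    · rw [if_pos (Or.inl h1), if_pos h1]
      have : 0 ≤ c₀ * ‖(if blockCoord (L ^ (n + 1)) m (siteCast (towerP_eq_fineP_pow L m (n + 1)) b.1) = y₂ then
          WL2.equiv ℂ (fun _ : Bond d (towerP L m (n + 1)) => c₀) W v b else 0)‖ ^ 2 := by positivity
      linarith
    · by_cases h2 : blockCoord (L ^ (n + 1)) m (siteCast (towerP_eq_fineP_pow L m (n + 1)) b.1) = y₂
      · rw [if_pos (Or.inr h2), if_neg h1, if_pos h2, norm_zero]
        nlinarith
      · rw [if_neg (not_or.mpr ⟨h1, h2⟩), if_neg h1, if_neg h2, norm_zero]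
        nlinarith
  have hsq : ‖v'‖ ^ 2 ≤ (‖PB y₁ v‖ + ‖PB y₂ v‖) ^ 2 := by
    calc ‖v'‖ ^ 2 = ∑ b, c₀ * ‖WL2.equiv ℂ (fun _ : Bond d (towerP L m (n + 1)) => c₀) W v' b‖ ^ 2 := WL2.norm_sq v'
      _ ≤ ∑ b, (c₀ * ‖WL2.equiv ℂ (fun _ : Bond d (towerP L m (n + 1)) => c₀) W (PB y₁ v) b‖ ^ 2 +
            c₀ * ‖WL2.equiv ℂ (fun _ : Bond d (towerP L m (n + 1)) => c₀) W (PB y₂ v) b‖ ^ 2) := Finset.sum_le_sum fun b _ => hterm b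
      _ = ‖PB y₁ v‖ ^ 2 + ‖PB y₂ v‖ ^ 2 := by rw [Finset.sum_add_distrib, ← WL2.norm_sq, ← WL2.norm_sq]
      _ ≤ (‖PB y₁ v‖ + ‖PB y₂ v‖) ^ 2 := by nlinarith [norm_nonneg (PB y₁ v), norm_nonneg (PB y₂ v)]
  have h3 := Real.sqrt_le_sqrt hsq
  rwa [Real.sqrt_sq (norm_nonneg _), Real.sqrt_sq (by positivity)] at h3

include hMφ hMφ' hφ hφ' hεU hUε hr0 hr1 hεs hεg hPB in
/-- **ONE VALUE OF `Q_kv` AGAINST TWO BLOCK NORMS, HEIGHT-FREE**: on the diagonal `c₁ = c₀(L^{n+1})^d` and the geometric bond window,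
`‖(Q_k(U)v)(c)‖ ≤ (C_Q∕√c₁)·(‖P_{c₋}v‖ + ‖P_{c₋+e_{c.2}}v‖)`, `C_Q = M_φ′M_φ·e^{√(L^d)√(2d)·102(d+1)²L·ε_s∕(1−r)}` — locality (§1) replaces `v` by its restriction to
the zone, `√c₁·|value| ≤ L²` norm, the height-free `L²` letter, `norm_restrict_le`.  A block AVERAGE costs no `(L^{n+1})^{d∕2}`. [folklore]
[cite: Balaban1985BackgroundPropagators, (3.15)–(3.16) p.393, (3.35)–(3.37) p.396; Balaban1985Averaging, p.24, (125)–(127) pp.36–37] -/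
theorem norm_equiv_QkW_apply_le_blocks (hc : c₁ = c₀ * ((L : ℝ) ^ (n + 1)) ^ d) (v : BondL2K ℂ d (towerP L m (n + 1)) c₀ W) (c : Bond d m) :
    ‖WL2.equiv ℂ (fun _ : Bond d m => c₁) W (QkW L m n φ U hL α hα1 hU1 hreg (c₀ := c₀) (c₁ := c₁) v) c‖ ≤
      (Mφ' * Mφ * Real.exp (Real.sqrt ((L : ℝ) ^ d) * (Real.sqrt (2 * d) * (102 * (d + 1) ^ 2 * L)) * (εs / (1 - r)))) / Real.sqrt c₁ *
        (‖PB c.1 v‖ + ‖PB (shift c.2 c.1) v‖) := by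
  have hc₁ : (0 : ℝ) < c₁ := Fact.out
  have hsc : 0 < Real.sqrt c₁ := Real.sqrt_pos.mpr hc₁
  set v' := (WL2.equiv ℂ (fun _ : Bond d (towerP L m (n + 1)) => c₀) W).symm (fun b =>
        if blockCoord (L ^ (n + 1)) m (siteCast (towerP_eq_fineP_pow L m (n + 1)) b.1) = c.1 ∨
            blockCoord (L ^ (n + 1)) m (siteCast (towerP_eq_fineP_pow L m (n + 1)) b.1) = shift c.2 c.1 then
          WL2.equiv ℂ (fun _ : Bond d (towerP L m (n + 1)) => c₀) W v b else 0) with hv'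
  -- locality: the value at `c` only reads the zone
  have hloc : WL2.equiv ℂ (fun _ : Bond d m => c₁) W (QkW L m n φ U hL α hα1 hU1 hreg (c₀ := c₀) (c₁ := c₁) v) c =
      WL2.equiv ℂ (fun _ : Bond d m => c₁) W (QkW L m n φ U hL α hα1 hU1 hreg (c₀ := c₀) (c₁ := c₁) v') c := by
    rw [equiv_QkW_apply, equiv_QkW_apply, QkOfU_congr_local L m n U hL α hα1 hU1 hreg c (fun b hb => ?_)]
    rw [hv', Equiv.apply_symm_apply, if_pos hb]
  rw [hloc]
  have h1 := sqrt_weight_mul_norm_apply_le m (QkW L m n φ U hL α hα1 hU1 hreg (c₀ := c₀) (c₁ := c₁) v') c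
  have h2 := norm_QkW_le_of_geometric_window_diagonal L m n hL φ hMφ hMφ' hφ hφ' U α hα1 hU1 hreg εU hεU hUε hr0 hr1 hεs hεg (c₀ := c₀) (c₁ := c₁) hc v'
  have h3 := norm_restrict_le L m n (hPB := hPB) v c.1 (shift c.2 c.1)
  rw [div_mul_eq_mul_div, le_div_iff₀ hsc, mul_comm]
  calc Real.sqrt c₁ * ‖WL2.equiv ℂ (fun _ : Bond d m => c₁) W (QkW L m n φ U hL α hα1 hU1 hreg (c₀ := c₀) (c₁ := c₁) v') c‖
      ≤ ‖QkW L m n φ U hL α hα1 hU1 hreg (c₀ := c₀) (c₁ := c₁) v'‖ := h1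
    _ ≤ Mφ' * Mφ * Real.exp (Real.sqrt ((L : ℝ) ^ d) * (Real.sqrt (2 * d) * (102 * (d + 1) ^ 2 * L)) * (εs / (1 - r))) * ‖v'‖ := h2
    _ ≤ Mφ' * Mφ * Real.exp (Real.sqrt ((L : ℝ) ^ d) * (Real.sqrt (2 * d) * (102 * (d + 1) ^ 2 * L)) * (εs / (1 - r))) *
          (‖PB c.1 v‖ + ‖PB (shift c.2 c.1) v‖) := mul_le_mul_of_nonneg_left h3 (by positivity)

/-! ## §3 The stencil letter of the tower penalty -/

omit [NeZero L] [∀ i, NeZero (m i)] [NormedAlgebra ℂ 𝔸] [CompleteSpace 𝔸] [NormOneClass 𝔸] [Fact (0 < c₁)] in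
/-- **THE ZONE's TWO BLOCKS ARE AMONG THE `2d+1` STENCIL BLOCKS** `Π(b₋)`, `Π(b₋) ± e_κ`: for a unit-lattice bond `c` with `Π(b₋) ∈ {c₋, c₋ + e_{c.2}}`,
`‖P_{c₋}v‖ + ‖P_{c₋+e_{c.2}}v‖ ≤ 2·Σ_{i ∈ Option(Fin d × Bool)} ‖P_{st(b,i)}v‖` (each of the two is one stencil term). [folklore]
[cite: Balaban1985BackgroundPropagators, (3.69) p.404, (3.49) p.399; Balaban1985Averaging, p.24] -/
theorem blocks_le_stencil_sum (v : BondL2K ℂ d (towerP L m (n + 1)) c₀ W) (b : Bond d (towerP L m (n + 1))) (c : Bond d m)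
    (hc : blockCoord (L ^ (n + 1)) m (siteCast (towerP_eq_fineP_pow L m (n + 1)) b.1) = c.1 ∨
        blockCoord (L ^ (n + 1)) m (siteCast (towerP_eq_fineP_pow L m (n + 1)) b.1) = shift c.2 c.1) :
    ‖PB c.1 v‖ + ‖PB (shift c.2 c.1) v‖ ≤
      2 * ∑ i : Option (Fin d × Bool), ‖PB (Option.elim i (blockCoord (L ^ (n + 1)) m (siteCast (towerP_eq_fineP_pow L m (n + 1)) b.1))
        (fun p => if p.2 then shift p.1 (blockCoord (L ^ (n + 1)) m (siteCast (towerP_eq_fineP_pow L m (n + 1)) b.1))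
          else unshift p.1 (blockCoord (L ^ (n + 1)) m (siteCast (towerP_eq_fineP_pow L m (n + 1)) b.1)))) v‖ := by
  set y := blockCoord (L ^ (n + 1)) m (siteCast (towerP_eq_fineP_pow L m (n + 1)) b.1) with hy
  set F : Option (Fin d × Bool) → ℝ := fun i => ‖PB (Option.elim i y (fun p => if p.2 then shift p.1 y else unshift p.1 y)) v‖ with hF
  have hF0 : ∀ i, 0 ≤ F i := fun i => norm_nonneg _
  have hone : ∀ i, F i ≤ ∑ i, F i := fun i => Finset.single_le_sum (fun i _ => hF0 i) (Finset.mem_univ i)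
  rcases hc with h | h
  · -- `c₋ = Π(b₋)`: the blocks are `st none` and `st (κ, +)`
    have e1 : ‖PB c.1 v‖ = F none := by simp only [hF, Option.elim, ← h]
    have e2 : ‖PB (shift c.2 c.1) v‖ = F (some (c.2, true)) := by simp only [hF, Option.elim, if_true, ← h]
    rw [e1, e2]; linarith [hone none, hone (some (c.2, true))]
  · -- `c₋ + e = Π(b₋)`: the blocks are `st (κ, −)` and `st none`
    have hc1 : c.1 = unshift c.2 y := by rw [h, unshift_shift]
    have e1 : ‖PB c.1 v‖ = F (some (c.2, false)) := by simp only [hF, Option.elim, hc1, Bool.false_eq_true, if_false]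
    have e2 : ‖PB (shift c.2 c.1) v‖ = F none := by simp only [hF, Option.elim, ← h]
    rw [e1, e2]; linarith [hone none, hone (some (c.2, false))]

variable [FiniteDimensional ℂ W]

include hα0 hMφ hMφ' hφ hφ' hεU hUε hr0 hr1 hεs hεg hPB in
/-- **THE STENCIL LETTER OF THE TOWER PENALTY, HEIGHT-FREE**: on the diagonal `c₀(L^{n+1})^d = c₁`, with the loop window `Σ_{j<n+1} α_j ≤ A` and the geometric
bond window, `‖((Q_k(U)†(a•Q_k(U)))v)(b)‖ ≤ p₂·Σ_{i ∈ Option(Fin d × Bool)} ‖P_{st(b,i)}v‖`,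
`p₂ = |a|·M_φ′M_φe^{100d(d+1)L^dA}·2d·2·C_Q∕√c₁` — (SBLT)'s penalty-from-values row at the zone values of §2; every constant free of the height `n`.
The `hq` block slot of (WKP)'s `norm_apply_le_decay_of_letters_stencil` for the local part `A₀,k`. [folklore]
[cite: Balaban1985BackgroundPropagators, (3.16) p.393, (3.26) p.395, (3.69) p.404, (3.35)–(3.37) p.396; Balaban1985Averaging, p.24, (125)–(127) pp.36–37] -/
theorem norm_penalty_QkW_apply_le_stencil [DecidableEq (Bond d (towerP L m (n + 1)))] {A : ℝ} (hA : ∑ j ∈ Finset.range (n + 1), α j ≤ A)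
    (hw : c₀ * ((L : ℝ) ^ (n + 1)) ^ d = c₁) (a : ℝ) (v : BondL2K ℂ d (towerP L m (n + 1)) c₀ W) (b : Bond d (towerP L m (n + 1))) :
    ‖WL2.equiv ℂ (fun _ : Bond d (towerP L m (n + 1)) => c₀) W
        ((LinearMap.adjoint (QkW L m n φ U hL α hα1 hU1 hreg (c₀ := c₀) (c₁ := c₁)) ∘ₗ
          ((a : ℂ) • QkW L m n φ U hL α hα1 hU1 hreg (c₀ := c₀) (c₁ := c₁))) v) b‖ ≤
      |a| * (Mφ' * Mφ * Real.exp (100 * d * (d + 1) * (L : ℝ) ^ d * A) * ((2 * d : ℕ) : ℝ) *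
          ((Mφ' * Mφ * Real.exp (Real.sqrt ((L : ℝ) ^ d) * (Real.sqrt (2 * d) * (102 * (d + 1) ^ 2 * L)) * (εs / (1 - r)))) / Real.sqrt c₁ *
            (2 * ∑ i : Option (Fin d × Bool), ‖PB (Option.elim i (blockCoord (L ^ (n + 1)) m (siteCast (towerP_eq_fineP_pow L m (n + 1)) b.1))
              (fun p => if p.2 then shift p.1 (blockCoord (L ^ (n + 1)) m (siteCast (towerP_eq_fineP_pow L m (n + 1)) b.1))
                else unshift p.1 (blockCoord (L ^ (n + 1)) m (siteCast (towerP_eq_fineP_pow L m (n + 1)) b.1)))) v‖))) := by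
  have hc : c₁ = c₀ * ((L : ℝ) ^ (n + 1)) ^ d := hw.symm
  refine norm_penalty_QkW_apply_le_local_of_values_diagonal L m n φ U hL α hα0 hα1 hU1 hreg hMφ hφ hMφ' hφ' hA hw a v b (by positivity)
    fun c hc' => ?_
  refine (norm_equiv_QkW_apply_le_blocks L m n φ U hL α hα1 hU1 hreg hMφ hφ hMφ' hφ' εU hεU hUε hr0 hr1 hεs hεg hPB hc v c).trans ?_
  exact mul_le_mul_of_nonneg_left (blocks_le_stencil_sum L m n v b c hc') (by positivity)

omit [NeZero L] [∀ i, NeZero (m i)] [Fact (0 < c₀)] [Fact (0 < c₁)] [FiniteDimensional ℂ W] in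
/-- **THE STENCIL STAYS WITHIN BLOCK DISTANCE `1`** of `Π(b₋)` (`1 ≤ m_i`): the `hst` binder of (WKP). [folklore]
[cite: Balaban1985BackgroundPropagators, (3.69) p.404, (3.49) p.399] -/
theorem tdist_stencil_le_one (hm : ∀ i, 1 ≤ m i) (y : TSite d m) (i : Option (Fin d × Bool)) :
    tdist m y (Option.elim i y (fun p => if p.2 then shift p.1 y else unshift p.1 y)) ≤ 1 := by
  rcases i with _ | ⟨κ, s⟩
  · simp only [Option.elim, tdist_self]; exact zero_le_one
  · cases s
    · simp only [Option.elim, Bool.false_eq_true, if_false]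
      have h := tdist_shift_le_one hm (unshift κ y) κ
      rwa [shift_unshift, tdist_symm hm] at h
    · simp only [Option.elim, if_true]
      exact tdist_shift_le_one hm y κ

end Literature.MathematicalPhysics.QuantumFieldTheory.Balaban1983to89.B9Eq316PenaltyStencilLetterTower

end
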